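import Mathlib.Algebra.BigOperators.Expect
import Mathlib.Data.Real.Basic
import Mathlib.Data.ZMod.Basic
import Mathlib.Order.Filter.AtTopBot.Basic
import HarnessLib

/-!
# Conlon–Fox–Zhao: the relative Szemerédi theorem and its linear forms condition

Topic `Literature/Combinatorics/Additive`. Source: D. Conlon, J. Fox, Y. Zhao, *The Green–Tao
theorem: an exposition*, EMS Surv. Math. Sci. 1 (2014), 249–282 = arXiv:1403.2957 (held as
`paper:arxiv-1403.2957`; theorem numbers below are those of the arXiv version), cited as
`ConlonFoxZhao2014`; the relative Szemerédi theorem itself is from D. Conlon, J. Fox, Y. Zhao,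
*A relative Szemerédi theorem*, GAFA 25 (2015).

This file vendors the *statements* of the transference half of the Green–Tao theorem in the
Conlon–Fox–Zhao form, which needs only a linear forms condition (no correlation condition):

* `CFZ.LinearFormsCondition k ν` — Definition 4.2 (the `k`-linear forms condition: the
  `k 2^{k-1}` forms `∑_i (j - i) x_i^{(ω_i)}`, `j ∈ [k]`, `ω ∈ {0,1}^{[k] ∖ {j}}`, in the `2k`
  variables `x_i^{(0)}, x_i^{(1)} ∈ ℤ_N`, have all sub-product averages `1 + o(1)`), for a family
  `ν = (ν_N)` and `N → ∞` through primes (the setting of the application; CFZ assume `N`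
  coprime to `(k-1)!`, footnote to Def. 4.2);
* the named fact `CFZ.RelativeSzemeredi` (Theorem 4.3). The weighted Szemerédi theorem
  (Thm. 4.1) is NOT restated — it is Green–Tao's Prop. 2.3, already in the tree as
  `Literature.NumberTheory.Sieve.GreenTao2008.SzemerediExpectation` (file `NumberTheory/Sieve/GreenTao2008`); the dense
  model theorem (Thm. 5.1), the cut norms (5.3) and the relative counting lemma (Thm. 6.5), from
  which §7 of the source proves Theorem 4.3, are left for the sibling PROOFS file.

Design: expectations are Mathlib's `Finset.expect` (`𝔼`); "`= 1 + o(1)`" is rendered as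
`∀ ε > 0, ∀ᶠ N, |… - 1| ≤ ε`; the pairs `(j, ω)` are normalised by `ω j = 0` (the form does not
involve `x_j`), so that sub-products are indexed by finsets of such pairs.

## References
* D. Conlon, J. Fox, Y. Zhao, *The Green–Tao theorem: an exposition*, EMS Surv. Math. Sci. 1
  (2014), 249–282, Def. 4.2, Thm. 4.3, §7. [cite: ConlonFoxZhao2014]
* D. Conlon, J. Fox, Y. Zhao, *A relative Szemerédi theorem*, Geom. Funct. Anal. 25 (2015),
  733–762 (the original of Thm. 4.3).
-/

noncomputable section

open Filter Finset
open scoped BigOperators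

namespace Literature.Combinatorics.Additive.CFZ

/-- The `(j, ω)`-th linear form of the `k`-AP system of Conlon–Fox–Zhao, Definition 4.2:
`ψ_{j,ω}(x) = ∑_{i=1}^k (j - i) x_i^{(ω_i)}` for `x = (x_i^{(0)}, x_i^{(1)})_{i ≤ k} ∈ ℤ_N^{2k}`
(indices from `0` here; the `i = j` term vanishes). [cite: ConlonFoxZhao2014, Definition 4.2] -/
def apForm {k N : ℕ} (j : Fin k) (ω : Fin k → Fin 2) (x : Fin k → Fin 2 → ZMod N) : ZMod N :=
  ∑ i : Fin k, (((j : ℕ) : ZMod N) - ((i : ℕ) : ZMod N)) * x i (ω i)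

/-- **Conlon–Fox–Zhao, Definition 4.2 (the `k`-linear forms condition)** for a family
`ν = (ν_N)`, `ν_N : ℤ_N → ℝ`: for every choice of exponents `n_{j,ω} ∈ {0,1}` (here: every finset
`E` of pairs `(j, ω)` with `ω ∈ {0,1}^{[k]}` normalised by `ω_j = 0`),
`E_{x ∈ ℤ_N^{2k}} ∏_{(j,ω) ∈ E} ν(∑_i (j - i) x_i^{(ω_i)}) = 1 + o(1)` as `N → ∞` through primes.
[cite: ConlonFoxZhao2014, Definition 4.2] -/
def LinearFormsCondition (k : ℕ) (ν : (N : ℕ) → ZMod N → ℝ) : Prop :=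
  ∀ E : Finset (Fin k × (Fin k → Fin 2)), (∀ e ∈ E, e.2 e.1 = 0) →
    ∀ ε : ℝ, 0 < ε → ∀ᶠ N : ℕ in atTop, ∀ [Fact N.Prime],
      |(𝔼 x : Fin k → Fin 2 → ZMod N, ∏ e ∈ E, ν N (apForm e.1 e.2 x)) - 1| ≤ ε

/-- **Conlon–Fox–Zhao, Theorem 4.3 (relative Szemerédi theorem).** Let `k ≥ 3` and `δ > 0`;
there is `c = c(k, δ) > 0` (the constant of the weighted Szemerédi theorem, Thm. 4.1 = the tree's
`Literature.NumberTheory.Sieve.GreenTao2008.SzemerediExpectation`) such that for every nonnegative family `ν` satisfying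
the `k`-linear forms condition and every `f : ℤ_N → ℝ` with `0 ≤ f ≤ ν_N`, `E(f) ≥ δ`:
`E_{x,d ∈ ℤ_N}[f(x) f(x+d) ⋯ f(x+(k-1)d)] ≥ c - o_{k,δ}(1)`, the rate depending also on the rates
in the linear forms condition (Remark after Thm. 4.3); `N → ∞` through primes. Proved in §§5–7
of the source from Thm. 4.1 via the dense model theorem and the relative counting lemma. Named
fact. [cite: ConlonFoxZhao2014, Theorem 4.3] -/
def RelativeSzemeredi : Prop :=
  ∀ k : ℕ, 3 ≤ k → ∀ δ : ℝ, 0 < δ → δ ≤ 1 → ∃ c : ℝ, 0 < c ∧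
    ∀ ν : (N : ℕ) → ZMod N → ℝ, (∀ N x, 0 ≤ ν N x) → LinearFormsCondition k ν →
      ∀ η : ℝ, 0 < η → ∀ᶠ N : ℕ in atTop, ∀ [Fact N.Prime], ∀ f : ZMod N → ℝ,
        (∀ x, 0 ≤ f x) → (∀ x, f x ≤ ν N x) → δ ≤ 𝔼 x, f x →
          c - η ≤ 𝔼 x : ZMod N, 𝔼 d : ZMod N, ∏ i : Fin k, f (x + (i : ℕ) * d)

/-! ### API -/

/-- Unfolding `apForm`. [cite: ConlonFoxZhao2014, Definition 4.2] -/
theorem apForm_def {k N : ℕ} (j : Fin k) (ω : Fin k → Fin 2) (x : Fin k → Fin 2 → ZMod N) :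
    apForm j ω x = ∑ i : Fin k, (((j : ℕ) : ZMod N) - ((i : ℕ) : ZMod N)) * x i (ω i) := rfl

/-- The forms `ψ_{j,ω}` evaluated along `x_i^{(0)} = x_i^{(1)} = y_i`: with `x = ψ_1`-value and
`d = ∑ y_i` one gets the `k`-AP `ψ_j = ψ_0 + j d` (§7: "setting `x = ψ_1(x_{-1})` and
`d = x_1 + ⋯ + x_k` so that `ψ_j(x_{-j}) = x + (j-1)d`"). [cite: ConlonFoxZhao2014, Section 7] -/
theorem apForm_diag {k N : ℕ} (j : Fin k) (ω : Fin k → Fin 2) (y : Fin k → ZMod N) :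
    apForm j ω (fun i _ => y i) = apForm ⟨0, Fin.pos j⟩ ω (fun i _ => y i) + (j : ℕ) * ∑ i, y i := by
  simp only [apForm, Nat.cast_zero, zero_sub, mul_sum, ← sum_add_distrib]
  refine sum_congr rfl fun i _ => ?_
  ring

/-- The constant family `ν ≡ 1` satisfies the `k`-linear forms condition (all averages are
exactly `1`). [cite: ConlonFoxZhao2014, Definition 4.2] -/
theorem linearFormsCondition_one (k : ℕ) : LinearFormsCondition k (fun _ _ => 1) := by
  intro E _ ε hε
  refine Filter.Eventually.of_forall fun N _ => ?_
  simp only [prod_const_one]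
  rw [expect_const univ_nonempty, sub_self, abs_zero]
  exact hε.le

end Literature.Combinatorics.Additive.CFZ
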